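import Literature.Geometry.Kaehler.ComplexTorusIntegralHodgeLatticeTopMinimalClassValueGroup
import Literature.Geometry.Kaehler.ComplexTorusMinimalClassesRing
import HarnessLib

/-!
# The middle Hodge lattice and its minimal class: on a polarised abelian variety of dimension `g = 2p` the top minimal class
# `γ_p = θ^{∧p}/(p!·d₁⋯d_p)` is UNIMODULAR for the cup product, `sign(e)·⟨γ_p, γ_p⟩_e = C(2p, p)·∏_{i<p} d_{p+i}/dᵢ > 0`, and
# `[Hdgᵖ(X, ℤ) : ℤγ_p ⊕ γ_p^⊥] · [ℤ : ⟨γ_p, Hdgᵖ(X, ℤ)⟩] = C(2p, p)·∏_{i<p} d_{p+i}/dᵢ`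

Layer `Literature/Geometry/Kaehler`, namespace `Literature.Geometry.Kaehler.ComplexTorus`; lane `lit-hodgefound`
(Track 2 foundations library), seat p09, generation 49, row g49-#1. THEOREMS ONLY (0 definitions); no named fact, net debt 0.
The MIDDLE-DEGREE END of the top splitting of g48-#5/#6 (`ComplexTorusIntegralHodgeLatticeTopMinimalClassSplitting`,
`…TopMinimalClassValueGroup`: `J_p · m_p · (p!·d₁⋯d_p)²·(q!·d₁⋯d_q) = g!·d₁⋯d_g`, `J_p · n_p · (p!·d₁⋯d_p)·((g−p)!·d₁⋯d_{g−p}) = g!·d₁⋯d_g` for the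
integral Lefschetz form `B = ⟨·, γ_q ∧ ·⟩_e` of `H^{2p}(X, ℤ)`, `2p + q = g`): when `g = 2p` the weight is `q = 0`, `γ_0 = θ^{∧0} = 1`, the form `B` is
THE CUP PRODUCT `⟨·,·⟩_e` of the middle cohomology `H^{2p}(X, ℤ)` — an even unimodular lattice `≅ U^{⊕ ½C(4p,2p)}` (the tree's
`ComplexTorusMiddleCohomologyLattice`) — and the Hodge lattice is the MIDDLE HODGE LATTICE `Hdgᵖ(X, ℤ) ⊂ H^{2p}(X, ℤ)` of
`ComplexTorusMiddleHodgeLatticeDiscriminant` (there: primitive, `[H : Hdg ⊕ T] = |disc Hdg|`). Here the minimal class `γ_p` inside it: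

* §0 (private plumbing) `⟨x, θ^{∧0} ∧ y⟩_e = ⟨x, y⟩_e` and the content `0!·(empty product) = 1`, so that every `q`-weighted theorem of the
  g45–g48 series specialises to the cup product.
* §1 **`γ_p` IS UNIMODULAR IN THE MIDDLE LATTICE: `⟨γ_p, H^{2p}(X, ℤ)⟩_e = ℤ`** (`IsPolarizationType.range_apply_minimalClass_eq_top_of_middle`; the value
  index `r_p` of g48-#6 is `1`): the minimal class is primitive (g36-#1) and primitive classes of a torus are unimodular (g41-#9
  `ComplexTorusMinimalClassesUnimodular`, Lange §6.2.4).
* §2 **THE SELF-INTERSECTION `sign(e)·⟨γ_p, γ_p⟩_e = C(2p, p)·(d₁⋯d_{2p})/(d₁⋯d_p)² = C(2p, p)·∏_{i<p} d_{p+i}/dᵢ`**, a POSITIVE integer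
  (`IsPolarizationType.orientationSign_mul_apply_minimalClass_self_eq_choose_mul`; from g36-#3 `torusIntegral_minimalClass_wedge_self`), and
  `sign(e)·(p!·d₁⋯d_p)²·⟨γ_p, γ_p⟩_e = (2p)!·d₁⋯d_{2p}` (the `q = 0`, `(−1)^{2p} = 1` case of g48-#5 §1).
* §3 **THE MIDDLE TOP SPLITTING `Hdgᵖ(X, ℤ) ⊇ ℤγ_p ⊕ γ_p^⊥`** (`γ_p^⊥` for the cup product restricted to `Hdgᵖ(X, ℤ)`):
  **`[Hdgᵖ(X, ℤ) : ℤγ_p ⊕ γ_p^⊥] · [ℤ : ⟨γ_p, Hdgᵖ(X, ℤ)⟩_e] = C(2p, p)·∏_{i<p} d_{p+i}/dᵢ`** (`IsPolarizationType.index_middle_splitting_mul_index_range_eq_choose_mul`),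
  `… · (p!·d₁⋯d_p)² = (2p)!·d₁⋯d_{2p}`, both indices positive, `ℤγ_p ∩ γ_p^⊥ = 0`, `rk γ_p^⊥ = rk Hdgᵖ(X, ℤ) − 1`; principal polarisation:
  **`[Hdgᵖ(X, ℤ) : ℤ(θ^p/p!) ⊕ (θ^p/p!)^⊥] · [ℤ : ⟨θ^p/p!, Hdgᵖ(X, ℤ)⟩] = C(2p, p)`** — abelian surface `2`, fourfold `6`, sixfold `20`; abelian surface of
  type `(d₁, d₂)`: `[NS(X) : ℤγ₁ ⊕ γ₁^⊥] · [ℤ : (γ₁·NS(X))] · d₁ = 2d₂` (`γ₁ = θ/d₁` the primitive polarisation class).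
* §4 **THE TWO EXTREMES.** `n_p := [ℤ : ⟨γ_p, Hdgᵖ(X, ℤ)⟩_e] = 1 ⟺ some integral Hodge class has intersection number `1` with `γ_p`**
  (`…index_range_restrict_eq_one_iff_of_middle`: over `ℤ` a subgroup is everything iff it contains `1`; since `⟨γ_p, H^{2p}(X, ℤ)⟩ = ℤ` this is «the unimodular
  partner of `γ_p` can be chosen of type `(p, p)`»), and then `[Hdgᵖ(X, ℤ) : ℤγ_p ⊕ γ_p^⊥] = C(2p, p)·∏ d_{p+i}/dᵢ` is MAXIMAL; at the other end
  **`[Hdgᵖ(X, ℤ) : ℤγ_p ⊕ γ_p^⊥] = 1 ⟺ n_p = C(2p, p)·∏ d_{p+i}/dᵢ ⟺ ⟨γ_p, Hdgᵖ(X, ℤ)⟩ = ⟨γ_p, γ_p⟩·ℤ`** (`…index_middle_splitting_eq_one_iff`), e.g. when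
  `Hdgᵖ(X, ℤ) = ℤγ_p` (Mattuck-general torus, g36-#1 §7).

## References

* [cite: Lange2023AbelianVarietiesComplex, §5.4.1 Thm. 5.4.2 and (5.22)–(5.23) (PDF p. 275); §2.5.3 Thm. 2.5.16, Cor. 2.5.17 (d) (PDF p. 135); §6.2.4 (PDF p. 310 L9–L13); §7.3.1 Lemma 7.3.6, Thm. 7.3.1 (PDF p. 336); §1.7.2 Lemma 1.7.5]
* [cite: BenoistDebarre2023SmoothSubvarietiesJacobians, §1 (p. 3); §3 Prop. 3.3 and proof of Thm. 3.7 (p. 7)]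
* [cite: VoisinHodgeI2002, §6.3.2 Lemma 6.31, Thm. 6.32–6.33 (PDF pp. 128–129); §7.1.2 (PDF p. 134)]
* [cite: Kitaoka1993, Ch. 5 Prop. 5.3.3 (proof)]
* [cite: Huybrechts2016K3, Ch. 14 §0.1–§0.2 (PDF p. 333); Ch. 3 §2.3]
-/

noncomputable section

-- `Module ℂ` / `SMulZeroClass ℂ` synthesis on `E [⋀^Fin k]→L[ℝ] ℂ` (as in `ComplexTorusLefschetzDecomposition`)
set_option maxSynthPendingDepth 3

open Module Function Complex
open LinearMap (BilinForm)
open Literature.LinearAlgebra.Alternating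
open Literature.Analysis.Complex (IsOfTypeAt typeSubmodule mem_typeSubmodule_iff_isOfTypeAt oneForm₀)

namespace Literature.Geometry.Kaehler.ComplexTorus

/-! ## §0 Plumbing: the Lefschetz form of weight `0` is the cup product -/

section Plumbing

variable {ι : Type*} [Fintype ι] [DecidableEq ι] {E : Type*} [NormedAddCommGroup E] [NormedSpace ℂ E]
  (Φ : (ι → ℝ) ≃L[ℝ] E) {n : ℕ}

omit [Fintype ι] in
/-- Re-reading the degree of the right argument of the Poincaré pairing. [folklore] -/
private theorem poincarePairing_domDomCongr_right₉₇ (e : Fin n ≃ ι) {k l l' : ℕ} (hl : l = l') (h : k + l = n) (h' : k + l' = n)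
    (γ : E [⋀^Fin k]→L[ℝ] ℂ) (δ : E [⋀^Fin l]→L[ℝ] ℂ) :
    poincarePairing Φ e h' γ (δ.domDomCongr (finCongr hl)) = poincarePairing Φ e h γ δ := by
  subst hl; rfl

omit [Fintype ι] in
/-- **`⟨x, θ^{∧0} ∧ y⟩_e = ⟨x, y⟩_e`**: the Lefschetz form of weight `q = 0` (`γ_0 = θ^{∧0} = 1`) is the cup product. [folklore] -/
private theorem poincarePairing_wedgePow_zero_wedge₉₇ (e : Fin n ≃ ι) (θ : E [⋀^Fin 2]→L[ℝ] ℂ) {k l : ℕ} (h₀ : k + (2 * 0 + l) = n)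
    (h : k + l = n) (x : E [⋀^Fin k]→L[ℝ] ℂ) (y : E [⋀^Fin l]→L[ℝ] ℂ) :
    poincarePairing Φ e h₀ x ((wedgePow θ 0).wedge y) = poincarePairing Φ e h x y := by
  rw [wedgePow_zero, oneForm₀, ContinuousAlternatingMap.constOfIsEmpty_one_wedge]
  exact poincarePairing_domDomCongr_right₉₇ Φ e (Nat.zero_add l).symm h h₀ x y

/-- The content in degree `0` is `1`: `θ^{∧0} = (0!·(empty product))·θ^{∧0}`. [folklore] -/
private theorem wedgePow_zero_eq_content_smul₉₇ (θ : E [⋀^Fin 2]→L[ℝ] ℂ) {g : ℕ} (d : Fin g → ℕ) (h0 : 0 ≤ g) :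
    wedgePow θ 0 = ((Nat.factorial 0 * ∏ i : Fin 0, d (Fin.castLE h0 i) : ℕ) : ℂ) • wedgePow θ 0 := by
  simp

omit [Fintype ι] in
/-- A cup-product form on `H^{2p}(X, ℤ)` is the Lefschetz form of weight `0`: `B(x, y) = ⟨x, y⟩_e = ⟨x, θ^{∧0} ∧ y⟩_e`. [folklore] -/
private theorem eq_poincarePairing_wedgePow_zero_wedge_of_eq_poincarePairing₉₇ (e : Fin n ≃ ι) (θ : E [⋀^Fin 2]→L[ℝ] ℂ) {k : ℕ}
    (h : k + k = n) (h₀ : k + (2 * 0 + k) = n) {B : BilinForm ℤ ↥(integralForms Φ k)}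
    (hB : ∀ x y : ↥(integralForms Φ k), ((B x y : ℤ) : ℂ) = poincarePairing Φ e h (x : E [⋀^Fin k]→L[ℝ] ℂ) (y : E [⋀^Fin k]→L[ℝ] ℂ))
    (x y : ↥(integralForms Φ k)) :
    ((B x y : ℤ) : ℂ) = poincarePairing Φ e h₀ (x : E [⋀^Fin k]→L[ℝ] ℂ) ((wedgePow θ 0).wedge (y : E [⋀^Fin k]→L[ℝ] ℂ)) := by
  rw [hB, poincarePairing_wedgePow_zero_wedge₉₇ Φ e θ h₀ h]

end Plumbing

/-! ## §1 The minimal class is unimodular in the middle lattice: `⟨γ_p, H^{2p}(X, ℤ)⟩_e = ℤ` -/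

section Unimodular

variable {ι : Type*} [Fintype ι] [DecidableEq ι] {E : Type*} [NormedAddCommGroup E] [NormedSpace ℂ E]
  {Φ : (ι → ℝ) ≃L[ℝ] E} {j n p : ℕ} {η : E [⋀^Fin 2]→L[ℝ] ℝ} {d : Fin (j + 2) → ℕ}

/-- **THE MINIMAL CLASS IS UNIMODULAR IN THE MIDDLE LATTICE: `⟨γ_p, H^{2p}(X, ℤ)⟩_e = ℤ`** for the cup product `B = ⟨·,·⟩_e` of the middle cohomology
`H^{2p}(X, ℤ)` of a polarised abelian variety of dimension `2p` and the minimal class `γ_p = θ^{∧p}/(p!·d₁⋯d_p)` (there is an integral `2p`-class `y` with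
`⟨γ_p, y⟩_e = 1`: `γ_p` is primitive, and primitive classes are unimodular by Poincaré duality over `ℤ`); so the value index `r_p = [ℤ : ⟨γ_p, H^{2p}(X, ℤ)⟩]` of
g48-#6 is `1` in the middle degree. [cite: Lange2023AbelianVarietiesComplex, §6.2.4 (PDF p. 310 L9–L13); §2.5.3 Thm. 2.5.16, Cor. 2.5.17 (PDF p. 135)] [cite: BenoistDebarre2023SmoothSubvarietiesJacobians, §1 (p. 3); §3 proof of Thm. 3.7 (p. 7)] -/
theorem IsPolarizationType.range_apply_minimalClass_eq_top_of_middle (hd : IsPolarizationType Φ η d) (hη : IsRiemannForm Φ η)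
    (hp : p ≤ j + 2) (e : Fin n ≃ ι) (hn : 2 * p + 2 * p = n) {B : BilinForm ℤ ↥(integralForms Φ (2 * p))}
    (hB : ∀ x y : ↥(integralForms Φ (2 * p)),
      ((B x y : ℤ) : ℂ) = poincarePairing Φ e hn (x : E [⋀^Fin (2 * p)]→L[ℝ] ℂ) (y : E [⋀^Fin (2 * p)]→L[ℝ] ℂ))
    (γpZ : ↥(integralForms Φ (2 * p)))
    (hγpZ : wedgePow (ofRealForm η) p = ((p.factorial * ∏ i : Fin p, d (Fin.castLE hp i) : ℕ) : ℂ) • (γpZ : E [⋀^Fin (2 * p)]→L[ℝ] ℂ)) :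
    (LinearMap.range (B γpZ)).toAddSubgroup = ⊤ ∧ (LinearMap.range (B γpZ)).toAddSubgroup.index = 1 ∧
      ∃ y : ↥(integralForms Φ (2 * p)), B γpZ y = 1 := by
  obtain ⟨y, hyZ, hy⟩ := hd.exists_poincarePairing_eq_one_of_wedgePow_eq_content_smul hη hp γpZ.2 hγpZ e hn
  have h1 : B γpZ ⟨y, hyZ⟩ = 1 := by exact_mod_cast (hB γpZ ⟨y, hyZ⟩).trans hy
  have htop : (LinearMap.range (B γpZ)).toAddSubgroup = ⊤ := by
    refine eq_top_iff.2 fun z _ ↦ (Submodule.mem_toAddSubgroup _).2 (LinearMap.mem_range.2 ⟨z • ⟨y, hyZ⟩, ?_⟩)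
    rw [map_zsmul, h1, zsmul_eq_mul, mul_one, Int.cast_id]
  exact ⟨htop, by rw [htop, AddSubgroup.index_top], ⟨y, hyZ⟩, h1⟩

end Unimodular

/-! ## §2 The self-intersection of the middle minimal class: `sign(e)·⟨γ_p, γ_p⟩_e = C(2p, p)·∏_{i<p} d_{p+i}/dᵢ > 0` -/

section SelfIntersection

variable {ι : Type*} [Fintype ι] [DecidableEq ι] {E : Type*} [NormedAddCommGroup E] [NormedSpace ℂ E]
  {Φ : (ι → ℝ) ≃L[ℝ] E} {j n p : ℕ} {η : E [⋀^Fin 2]→L[ℝ] ℝ} {d : Fin (j + 2) → ℕ}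

/-- **`sign(e)·⟨γ_p, γ_p⟩_e = C(2p, p)·(d₁⋯d_{2p})/((d₁⋯d_p)·(d₁⋯d_p))`** in `ℤ`, for the cup product `B = ⟨·,·⟩_e` on `H^{2p}(X, ℤ)` of a polarised abelian
variety of dimension `2p` and type `(d₁, …, d_{2p})` (`⟨γ, γ⟩_e = sign(e)·∫_X γ ∧ γ` and `∫_X γ_p ∧ γ_p = C(2p, p)·∏_{i<p} d_{p+i}/dᵢ`, g36-#3): the
self-intersection of the minimal class is the POSITIVE integer `C(2p, p)·∏_{i<p} d_{p+i}/dᵢ` (abelian surface of type `(1, d)`: `2d`; principally polarised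
fourfold: `6`). [cite: Lange2023AbelianVarietiesComplex, §7.3.1 Lemma 7.3.6 and Thm. 7.3.1 (PDF p. 336); §2.5.3 Cor. 2.5.17 (d) (PDF p. 135); §6.2.4 (PDF p. 310)] [cite: BenoistDebarre2023SmoothSubvarietiesJacobians, §3 Prop. 3.3] -/
theorem IsPolarizationType.orientationSign_mul_apply_minimalClass_self_eq_choose_mul (hd : IsPolarizationType Φ η d) (hη : IsRiemannForm Φ η)
    (hp : p ≤ j + 2) (hg : p + p = j + 2) (e : Fin n ≃ ι) (hn : 2 * p + 2 * p = n) {B : BilinForm ℤ ↥(integralForms Φ (2 * p))}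
    (hB : ∀ x y : ↥(integralForms Φ (2 * p)),
      ((B x y : ℤ) : ℂ) = poincarePairing Φ e hn (x : E [⋀^Fin (2 * p)]→L[ℝ] ℂ) (y : E [⋀^Fin (2 * p)]→L[ℝ] ℂ))
    (γpZ : ↥(integralForms Φ (2 * p)))
    (hγpZ : wedgePow (ofRealForm η) p = ((p.factorial * ∏ i : Fin p, d (Fin.castLE hp i) : ℕ) : ℂ) • (γpZ : E [⋀^Fin (2 * p)]→L[ℝ] ℂ)) :
    orientationSign Φ e * B γpZ γpZ =
        (((j + 2).choose p * ((∏ i, d i) / ((∏ i : Fin p, d (Fin.castLE hp i)) * ∏ i : Fin p, d (Fin.castLE hp i))) : ℕ) : ℤ) ∧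
      0 < orientationSign Φ e * B γpZ γpZ ∧
      (B γpZ γpZ).natAbs = (j + 2).choose p * ((∏ i, d i) / ((∏ i : Fin p, d (Fin.castLE hp i)) * ∏ i : Fin p, d (Fin.castLE hp i))) := by
  subst hn
  have hint := hd.torusIntegral_minimalClass_wedge_self hη hp hg e hγpZ
  have hs1 := orientationSign_mul_self Φ e
  have h1 : ((orientationSign Φ e * B γpZ γpZ : ℤ) : ℂ) =
      (((j + 2).choose p * ((∏ i, d i) / ((∏ i : Fin p, d (Fin.castLE hp i)) * ∏ i : Fin p, d (Fin.castLE hp i))) : ℕ) : ℤ) := by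
    have he : (finCongr (rfl : 2 * p + 2 * p = 2 * p + 2 * p)).trans e = e := Equiv.ext fun _ ↦ rfl
    rw [Int.cast_mul, hB, poincarePairing_eq_orientationSign_mul_torusIntegral_wedge Φ e rfl, he, hint, ← mul_assoc, ← Int.cast_mul, hs1,
      Int.cast_one, one_mul, Int.cast_natCast]
  have hZ : orientationSign Φ e * B γpZ γpZ =
      (((j + 2).choose p * ((∏ i, d i) / ((∏ i : Fin p, d (Fin.castLE hp i)) * ∏ i : Fin p, d (Fin.castLE hp i))) : ℕ) : ℤ) := by
    exact_mod_cast h1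
  -- positivity: the quotient is a genuine quotient of positive integers (`D_p·D_p ∣ D_{2p}`)
  have hD : (∏ i : Fin p, d (Fin.castLE hp i)) * ∏ i : Fin p, d (Fin.castLE hp i) ∣ ∏ i, d i := by
    have h := prod_castLE_mul_prod_castLE_dvd hd.1 hp hp (le_of_eq hg)
    have hc : (fun i : Fin (p + p) ↦ d (Fin.castLE (le_of_eq hg) i)) = fun i ↦ d (finCongr hg i) := funext fun i ↦ rfl
    rw [hc] at h
    rwa [Fintype.prod_equiv (finCongr hg) (fun i ↦ d (finCongr hg i)) (fun i ↦ d i) fun _ ↦ rfl] at h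
  have hpos : 0 < (j + 2).choose p * ((∏ i, d i) / ((∏ i : Fin p, d (Fin.castLE hp i)) * ∏ i : Fin p, d (Fin.castLE hp i))) := by
    refine Nat.mul_pos (Nat.choose_pos hp) (Nat.div_pos (Nat.le_of_dvd (Finset.prod_pos fun i _ ↦ hd.pos hη i) hD) ?_)
    exact Nat.mul_pos (Finset.prod_pos fun i _ ↦ hd.pos hη _) (Finset.prod_pos fun i _ ↦ hd.pos hη _)
  refine ⟨hZ, by rw [hZ]; exact_mod_cast hpos, ?_⟩
  have habs := congrArg Int.natAbs hZ
  have hs : (orientationSign Φ e).natAbs = 1 := by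
    have h2 := congrArg Int.natAbs hs1
    rw [Int.natAbs_mul, Int.natAbs_one] at h2
    exact Nat.eq_one_of_mul_eq_one_left h2
  rwa [Int.natAbs_mul, hs, one_mul, Int.natAbs_natCast] at habs

/-- **`sign(e)·(p!·d₁⋯d_p)²·⟨γ_p, γ_p⟩_e = (2p)!·d₁⋯d_{2p}`** — the `q = 0`, `(−1)^g = (−1)^{2p} = 1` case of g48-#5's self-intersection formula
`sign(e)·(p!·d₁⋯d_p)²·(q!·d₁⋯d_q)·B(γ_p, γ_p) = (−1)^g·g!·d₁⋯d_g`. [cite: Lange2023AbelianVarietiesComplex, §2.5.3 Cor. 2.5.17 (d) (PDF p. 135); §1.7.2 Lemma 1.7.5; §6.2.4 (PDF p. 310)] -/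
theorem IsPolarizationType.orientationSign_mul_content_sq_mul_apply_minimalClass_self_of_middle (hd : IsPolarizationType Φ η d)
    (hη : IsRiemannForm Φ η) (hp : p ≤ j + 2) (hg : p + p = j + 2) (e : Fin n ≃ ι) (hn : 2 * p + 2 * p = n)
    {B : BilinForm ℤ ↥(integralForms Φ (2 * p))}
    (hB : ∀ x y : ↥(integralForms Φ (2 * p)),
      ((B x y : ℤ) : ℂ) = poincarePairing Φ e hn (x : E [⋀^Fin (2 * p)]→L[ℝ] ℂ) (y : E [⋀^Fin (2 * p)]→L[ℝ] ℂ))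
    (γpZ : ↥(integralForms Φ (2 * p)))
    (hγpZ : wedgePow (ofRealForm η) p = ((p.factorial * ∏ i : Fin p, d (Fin.castLE hp i) : ℕ) : ℂ) • (γpZ : E [⋀^Fin (2 * p)]→L[ℝ] ℂ)) :
    orientationSign Φ e * (((p.factorial * ∏ i : Fin p, d (Fin.castLE hp i)) ^ 2 : ℕ) : ℤ) * B γpZ γpZ = (((j + 2).factorial * ∏ i, d i : ℕ) : ℤ) ∧
      (B γpZ γpZ).natAbs * (p.factorial * ∏ i : Fin p, d (Fin.castLE hp i)) ^ 2 = (j + 2).factorial * ∏ i, d i := by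
  have hn₀ : 2 * p + (2 * 0 + 2 * p) = n := by omega
  have hg₀ : p + (0 + p) = j + 2 := by omega
  have hB₀ := eq_poincarePairing_wedgePow_zero_wedge_of_eq_poincarePairing₉₇ Φ e (ofRealForm η) hn hn₀ hB
  have hγ0 := wedgePow_zero_eq_content_smul₉₇ (ofRealForm η) d (Nat.zero_le (j + 2))
  have h1 := hd.orientationSign_mul_content_mul_apply_minimalClass_self hη hp (Nat.zero_le _) hg₀ hγpZ hγ0 e hn₀ hB₀ γpZ rfl
  have h2 := hd.natAbs_apply_minimalClass_self_mul_content_eq hη hp (Nat.zero_le _) hg₀ hγpZ hγ0 e hn₀ hB₀ γpZ rfl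
  have heven : Even (j + 2) := ⟨p, hg.symm⟩
  simp only [Nat.factorial_zero, Finset.univ_eq_empty, Finset.prod_empty, mul_one, heven.neg_one_pow, one_mul] at h1 h2
  exact ⟨h1, h2.1⟩

end SelfIntersection

/-! ## §3 The middle top splitting `Hdgᵖ(X, ℤ) ⊇ ℤγ_p ⊕ γ_p^⊥` and its index -/

section Splitting

variable {ι : Type*} [Fintype ι] [DecidableEq ι] {E : Type*} [NormedAddCommGroup E] [NormedSpace ℂ E]
  {Φ : (ι → ℝ) ≃L[ℝ] E} {j n p : ℕ} {η : E [⋀^Fin 2]→L[ℝ] ℝ} {d : Fin (j + 2) → ℕ}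

/-- **THE INDEX OF THE MIDDLE TOP SPLITTING: `[Hdgᵖ(X, ℤ) : ℤγ_p ⊕ γ_p^⊥] · [ℤ : ⟨γ_p, Hdgᵖ(X, ℤ)⟩_e] · (p!·d₁⋯d_p)² = (2p)!·d₁⋯d_{2p}`** for the cup product
`B = ⟨·,·⟩_e` of `H^{2p}(X, ℤ)` on a polarised abelian variety of dimension `2p` (`M = Hdgᵖ(X, ℤ) ⊂ H^{2p}(X, ℤ)` the middle Hodge lattice, `B_M = B∣M`, `Λ = ℤγ_p`,
`γ_p^⊥ = Λ^⊥` for `B_M`; the second factor is the index in `ℤ` of the intersection numbers `{⟨γ_p, x⟩ : x ∈ Hdgᵖ(X, ℤ)}`): the `q = 0` case of g48-#5/#6, where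
`m_p = n_p` because `⟨γ_p, H^{2p}(X, ℤ)⟩ = ℤ` (§1); `J_p · n_p = |⟨γ_p, γ_p⟩|`, both indices positive.
[cite: Lange2023AbelianVarietiesComplex, §5.4.1 Thm. 5.4.2 and (5.22)–(5.23) (PDF p. 275); §2.5.3 Cor. 2.5.17 (d) (PDF p. 135); §7.3.1 Thm. 7.3.1] [cite: Kitaoka1993, Ch. 5 Prop. 5.3.3 (proof)] [cite: Huybrechts2016K3, Ch. 14 §0.2] -/
theorem IsPolarizationType.index_middle_splitting_mul_index_range_mul_content_sq_eq (hd : IsPolarizationType Φ η d) (hη : IsRiemannForm Φ η)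
    (hp : p ≤ j + 2) (hg : p + p = j + 2) (e : Fin n ≃ ι) (hn : 2 * p + 2 * p = n) {B : BilinForm ℤ ↥(integralForms Φ (2 * p))}
    (hB : ∀ x y : ↥(integralForms Φ (2 * p)),
      ((B x y : ℤ) : ℂ) = poincarePairing Φ e hn (x : E [⋀^Fin (2 * p)]→L[ℝ] ℂ) (y : E [⋀^Fin (2 * p)]→L[ℝ] ℂ))
    (γM : ↥(AddSubgroup.toIntSubmodule ((integralHodgeClassesIn Φ (2 * p) p).addSubgroupOf (integralForms Φ (2 * p)))))
    (hγM : wedgePow (ofRealForm η) p = ((p.factorial * ∏ i : Fin p, d (Fin.castLE hp i) : ℕ) : ℂ) •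
      (((γM : ↥(AddSubgroup.toIntSubmodule ((integralHodgeClassesIn Φ (2 * p) p).addSubgroupOf (integralForms Φ (2 * p))))) : ↥(integralForms Φ (2 * p))) : E [⋀^Fin (2 * p)]→L[ℝ] ℂ))
    (Λ : Submodule ℤ ↥(AddSubgroup.toIntSubmodule ((integralHodgeClassesIn Φ (2 * p) p).addSubgroupOf (integralForms Φ (2 * p))))) (hΛ : ∀ x, x ∈ Λ ↔ ∃ a : ℤ, a • γM = x) :
    (Λ ⊔ (B.restrict (AddSubgroup.toIntSubmodule ((integralHodgeClassesIn Φ (2 * p) p).addSubgroupOf (integralForms Φ (2 * p))))).orthogonal Λ).toAddSubgroup.index * (LinearMap.range (B.restrict (AddSubgroup.toIntSubmodule ((integralHodgeClassesIn Φ (2 * p) p).addSubgroupOf (integralForms Φ (2 * p)))) γM)).toAddSubgroup.index *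
        (p.factorial * ∏ i : Fin p, d (Fin.castLE hp i)) ^ 2 = (j + 2).factorial * ∏ i, d i ∧
      (Λ ⊔ (B.restrict (AddSubgroup.toIntSubmodule ((integralHodgeClassesIn Φ (2 * p) p).addSubgroupOf (integralForms Φ (2 * p))))).orthogonal Λ).toAddSubgroup.index * (LinearMap.range (B.restrict (AddSubgroup.toIntSubmodule ((integralHodgeClassesIn Φ (2 * p) p).addSubgroupOf (integralForms Φ (2 * p)))) γM)).toAddSubgroup.index =
        (B (γM : ↥(integralForms Φ (2 * p))) (γM : ↥(integralForms Φ (2 * p)))).natAbs ∧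
      0 < (Λ ⊔ (B.restrict (AddSubgroup.toIntSubmodule ((integralHodgeClassesIn Φ (2 * p) p).addSubgroupOf (integralForms Φ (2 * p))))).orthogonal Λ).toAddSubgroup.index ∧ 0 < (LinearMap.range (B.restrict (AddSubgroup.toIntSubmodule ((integralHodgeClassesIn Φ (2 * p) p).addSubgroupOf (integralForms Φ (2 * p)))) γM)).toAddSubgroup.index := by
  have hn₀ : 2 * p + (2 * 0 + 2 * p) = n := by omega
  have hg₀ : p + (0 + p) = j + 2 := by omega
  have hB₀ := eq_poincarePairing_wedgePow_zero_wedge_of_eq_poincarePairing₉₇ Φ e (ofRealForm η) hn hn₀ hB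
  have hγ0 := wedgePow_zero_eq_content_smul₉₇ (ofRealForm η) d (Nat.zero_le (j + 2))
  have h := hd.index_top_splitting_mul_index_range_mul_content_eq hη hp (Nat.zero_le _) hg₀ hγ0 e hn₀ hB₀ γM hγM Λ hΛ
  simp only [Nat.factorial_zero, Finset.univ_eq_empty, Finset.prod_empty, mul_one] at h
  exact h

/-- **`[Hdgᵖ(X, ℤ) : ℤγ_p ⊕ γ_p^⊥] · [ℤ : ⟨γ_p, Hdgᵖ(X, ℤ)⟩_e] = C(2p, p)·(d₁⋯d_{2p})/((d₁⋯d_p)(d₁⋯d_p)) = C(2p, p)·∏_{i<p} d_{p+i}/dᵢ`** — the product of the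
index of the middle top splitting and the index of the intersection numbers of `γ_p` with the Hodge lattice is the self-intersection of the minimal class (§2);
in particular **`[Hdgᵖ(X, ℤ) : ℤγ_p ⊕ γ_p^⊥]` divides `C(2p, p)·∏_{i<p} d_{p+i}/dᵢ`**.
[cite: Lange2023AbelianVarietiesComplex, §5.4.1 (5.22)–(5.23) (PDF p. 275); §7.3.1 Lemma 7.3.6, Thm. 7.3.1 (PDF p. 336); §2.5.3 Cor. 2.5.17 (d)] [cite: BenoistDebarre2023SmoothSubvarietiesJacobians, §3 Prop. 3.3] [cite: Kitaoka1993, Ch. 5 Prop. 5.3.3 (proof)] -/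
theorem IsPolarizationType.index_middle_splitting_mul_index_range_eq_choose_mul (hd : IsPolarizationType Φ η d) (hη : IsRiemannForm Φ η)
    (hp : p ≤ j + 2) (hg : p + p = j + 2) (e : Fin n ≃ ι) (hn : 2 * p + 2 * p = n) {B : BilinForm ℤ ↥(integralForms Φ (2 * p))}
    (hB : ∀ x y : ↥(integralForms Φ (2 * p)),
      ((B x y : ℤ) : ℂ) = poincarePairing Φ e hn (x : E [⋀^Fin (2 * p)]→L[ℝ] ℂ) (y : E [⋀^Fin (2 * p)]→L[ℝ] ℂ))
    (γM : ↥(AddSubgroup.toIntSubmodule ((integralHodgeClassesIn Φ (2 * p) p).addSubgroupOf (integralForms Φ (2 * p)))))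
    (hγM : wedgePow (ofRealForm η) p = ((p.factorial * ∏ i : Fin p, d (Fin.castLE hp i) : ℕ) : ℂ) •
      (((γM : ↥(AddSubgroup.toIntSubmodule ((integralHodgeClassesIn Φ (2 * p) p).addSubgroupOf (integralForms Φ (2 * p))))) : ↥(integralForms Φ (2 * p))) : E [⋀^Fin (2 * p)]→L[ℝ] ℂ))
    (Λ : Submodule ℤ ↥(AddSubgroup.toIntSubmodule ((integralHodgeClassesIn Φ (2 * p) p).addSubgroupOf (integralForms Φ (2 * p))))) (hΛ : ∀ x, x ∈ Λ ↔ ∃ a : ℤ, a • γM = x) :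
    (Λ ⊔ (B.restrict (AddSubgroup.toIntSubmodule ((integralHodgeClassesIn Φ (2 * p) p).addSubgroupOf (integralForms Φ (2 * p))))).orthogonal Λ).toAddSubgroup.index * (LinearMap.range (B.restrict (AddSubgroup.toIntSubmodule ((integralHodgeClassesIn Φ (2 * p) p).addSubgroupOf (integralForms Φ (2 * p)))) γM)).toAddSubgroup.index =
        (j + 2).choose p * ((∏ i, d i) / ((∏ i : Fin p, d (Fin.castLE hp i)) * ∏ i : Fin p, d (Fin.castLE hp i))) ∧
      (Λ ⊔ (B.restrict (AddSubgroup.toIntSubmodule ((integralHodgeClassesIn Φ (2 * p) p).addSubgroupOf (integralForms Φ (2 * p))))).orthogonal Λ).toAddSubgroup.index ∣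
        (j + 2).choose p * ((∏ i, d i) / ((∏ i : Fin p, d (Fin.castLE hp i)) * ∏ i : Fin p, d (Fin.castLE hp i))) := by
  have h := (hd.index_middle_splitting_mul_index_range_mul_content_sq_eq hη hp hg e hn hB γM hγM Λ hΛ).2.1
  rw [(hd.orientationSign_mul_apply_minimalClass_self_eq_choose_mul hη hp hg e hn hB (γM : ↥(integralForms Φ (2 * p))) hγM).2.2] at h
  exact ⟨h, Dvd.intro _ h⟩

/-- **Principal polarisation: `[Hdgᵖ(X, ℤ) : ℤ(θ^p/p!) ⊕ (θ^p/p!)^⊥] · [ℤ : ⟨θ^p/p!, Hdgᵖ(X, ℤ)⟩_e] = C(2p, p)`** on a principally polarised abelian variety of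
dimension `2p` (abelian surface `2`, fourfold `6`, sixfold `20`), so the index of the middle top splitting divides the middle binomial coefficient.
[cite: Lange2023AbelianVarietiesComplex, §5.4.1 (5.22)–(5.23) (PDF p. 275); §7.3.1 Thm. 7.3.1; §2.1.1] [cite: BenoistDebarre2023SmoothSubvarietiesJacobians, §1 (p. 3); §3 Prop. 3.3] -/
theorem IsPolarizationType.index_middle_splitting_mul_index_range_eq_choose_of_type_one (hd : IsPolarizationType Φ η d) (hη : IsRiemannForm Φ η)
    (h1 : ∀ i, d i = 1) (hp : p ≤ j + 2) (hg : p + p = j + 2) (e : Fin n ≃ ι) (hn : 2 * p + 2 * p = n)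
    {B : BilinForm ℤ ↥(integralForms Φ (2 * p))}
    (hB : ∀ x y : ↥(integralForms Φ (2 * p)),
      ((B x y : ℤ) : ℂ) = poincarePairing Φ e hn (x : E [⋀^Fin (2 * p)]→L[ℝ] ℂ) (y : E [⋀^Fin (2 * p)]→L[ℝ] ℂ))
    (γM : ↥(AddSubgroup.toIntSubmodule ((integralHodgeClassesIn Φ (2 * p) p).addSubgroupOf (integralForms Φ (2 * p)))))
    (hγM : wedgePow (ofRealForm η) p = ((p.factorial * ∏ i : Fin p, d (Fin.castLE hp i) : ℕ) : ℂ) •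
      (((γM : ↥(AddSubgroup.toIntSubmodule ((integralHodgeClassesIn Φ (2 * p) p).addSubgroupOf (integralForms Φ (2 * p))))) : ↥(integralForms Φ (2 * p))) : E [⋀^Fin (2 * p)]→L[ℝ] ℂ))
    (Λ : Submodule ℤ ↥(AddSubgroup.toIntSubmodule ((integralHodgeClassesIn Φ (2 * p) p).addSubgroupOf (integralForms Φ (2 * p))))) (hΛ : ∀ x, x ∈ Λ ↔ ∃ a : ℤ, a • γM = x) :
    (Λ ⊔ (B.restrict (AddSubgroup.toIntSubmodule ((integralHodgeClassesIn Φ (2 * p) p).addSubgroupOf (integralForms Φ (2 * p))))).orthogonal Λ).toAddSubgroup.index * (LinearMap.range (B.restrict (AddSubgroup.toIntSubmodule ((integralHodgeClassesIn Φ (2 * p) p).addSubgroupOf (integralForms Φ (2 * p)))) γM)).toAddSubgroup.index = (j + 2).choose p ∧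
      (Λ ⊔ (B.restrict (AddSubgroup.toIntSubmodule ((integralHodgeClassesIn Φ (2 * p) p).addSubgroupOf (integralForms Φ (2 * p))))).orthogonal Λ).toAddSubgroup.index ∣ (j + 2).choose p := by
  have h := (hd.index_middle_splitting_mul_index_range_eq_choose_mul hη hp hg e hn hB γM hγM Λ hΛ).1
  simp only [h1, Finset.prod_const_one, mul_one, Nat.div_one] at h
  exact ⟨h, Dvd.intro _ h⟩

/-- **The middle top splitting is a splitting: `ℤγ_p ∩ γ_p^⊥ = 0`, `⟨·,·⟩∣ℤγ_p` non-degenerate, `rk ℤγ_p = 1`, `rk ℤγ_p + rk γ_p^⊥ = rk Hdgᵖ(X, ℤ)`** for the cup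
product on the middle Hodge lattice. [cite: Lange2023AbelianVarietiesComplex, §5.4.1 Thm. 5.4.2 and (5.22) (PDF p. 275); §7.3.1 Thm. 7.3.1] [cite: VoisinHodgeI2002, §6.3.2 Lemma 6.31 (PDF p. 128)] [cite: Kitaoka1993, Ch. 5 Prop. 5.3.3] -/
theorem IsPolarizationType.middle_splitting (hd : IsPolarizationType Φ η d) (hη : IsRiemannForm Φ η)
    (hp : p ≤ j + 2) (hg : p + p = j + 2) (e : Fin n ≃ ι) (hn : 2 * p + 2 * p = n) {B : BilinForm ℤ ↥(integralForms Φ (2 * p))}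
    (hB : ∀ x y : ↥(integralForms Φ (2 * p)),
      ((B x y : ℤ) : ℂ) = poincarePairing Φ e hn (x : E [⋀^Fin (2 * p)]→L[ℝ] ℂ) (y : E [⋀^Fin (2 * p)]→L[ℝ] ℂ))
    (γM : ↥(AddSubgroup.toIntSubmodule ((integralHodgeClassesIn Φ (2 * p) p).addSubgroupOf (integralForms Φ (2 * p)))))
    (hγM : wedgePow (ofRealForm η) p = ((p.factorial * ∏ i : Fin p, d (Fin.castLE hp i) : ℕ) : ℂ) •
      (((γM : ↥(AddSubgroup.toIntSubmodule ((integralHodgeClassesIn Φ (2 * p) p).addSubgroupOf (integralForms Φ (2 * p))))) : ↥(integralForms Φ (2 * p))) : E [⋀^Fin (2 * p)]→L[ℝ] ℂ))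
    (Λ : Submodule ℤ ↥(AddSubgroup.toIntSubmodule ((integralHodgeClassesIn Φ (2 * p) p).addSubgroupOf (integralForms Φ (2 * p))))) (hΛ : ∀ x, x ∈ Λ ↔ ∃ a : ℤ, a • γM = x) :
    Λ ⊓ (B.restrict (AddSubgroup.toIntSubmodule ((integralHodgeClassesIn Φ (2 * p) p).addSubgroupOf (integralForms Φ (2 * p))))).orthogonal Λ = ⊥ ∧ ((B.restrict (AddSubgroup.toIntSubmodule ((integralHodgeClassesIn Φ (2 * p) p).addSubgroupOf (integralForms Φ (2 * p))))).restrict Λ).Nondegenerate ∧ finrank ℤ ↥Λ = 1 ∧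
      finrank ℤ ↥Λ + finrank ℤ ↥((B.restrict (AddSubgroup.toIntSubmodule ((integralHodgeClassesIn Φ (2 * p) p).addSubgroupOf (integralForms Φ (2 * p))))).orthogonal Λ) = finrank ℤ ↥(AddSubgroup.toIntSubmodule ((integralHodgeClassesIn Φ (2 * p) p).addSubgroupOf (integralForms Φ (2 * p)))) := by
  have hn₀ : 2 * p + (2 * 0 + 2 * p) = n := by omega
  have hg₀ : p + (0 + p) = j + 2 := by omega
  have hB₀ := eq_poincarePairing_wedgePow_zero_wedge_of_eq_poincarePairing₉₇ Φ e (ofRealForm η) hn hn₀ hB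
  have hγ0 := wedgePow_zero_eq_content_smul₉₇ (ofRealForm η) d (Nat.zero_le (j + 2))
  exact hd.top_splitting hη hp (Nat.zero_le _) hg₀ hγ0 e hn₀ hB₀ γM hγM Λ hΛ

end Splitting

/-! ## §4 The two extremes: `[ℤ : ⟨γ_p, Hdgᵖ(X, ℤ)⟩] = 1` and `[Hdgᵖ(X, ℤ) : ℤγ_p ⊕ γ_p^⊥] = 1` -/

section Extremes

variable {ι : Type*} [Fintype ι] [DecidableEq ι] {E : Type*} [NormedAddCommGroup E] [NormedSpace ℂ E]
  {Φ : (ι → ℝ) ≃L[ℝ] E} {j n p : ℕ} {η : E [⋀^Fin 2]→L[ℝ] ℝ} {d : Fin (j + 2) → ℕ}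

omit [Fintype ι] [DecidableEq ι] in
/-- Over `ℤ`: the value group `{B_M(γ, y) : y ∈ M}` of an element of a lattice has index `1` iff it contains `1`. [folklore] -/
private theorem index_range_eq_one_iff_exists_eq_one₉₇ {V : Type*} [AddCommGroup V] (B : BilinForm ℤ V) (γ : V) :
    (LinearMap.range (B γ)).toAddSubgroup.index = 1 ↔ ∃ y, B γ y = 1 := by
  rw [AddSubgroup.index_eq_one]
  constructor
  · intro h
    have h1 : (1 : ℤ) ∈ (LinearMap.range (B γ)).toAddSubgroup := h ▸ AddSubgroup.mem_top _
    exact LinearMap.mem_range.1 ((Submodule.mem_toAddSubgroup _).1 h1)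
  · rintro ⟨y, hy⟩
    refine eq_top_iff.2 fun z _ ↦ (Submodule.mem_toAddSubgroup _).2 (LinearMap.mem_range.2 ⟨z • y, ?_⟩)
    rw [map_zsmul, hy, zsmul_eq_mul, mul_one, Int.cast_id]

/-- **`[ℤ : ⟨γ_p, Hdgᵖ(X, ℤ)⟩_e] = 1` iff some integral Hodge class `y ∈ Hdgᵖ(X, ℤ)` has `⟨γ_p, y⟩_e = 1`** — since `⟨γ_p, H^{2p}(X, ℤ)⟩ = ℤ` (§1) this says:
the unimodular partner of the minimal class can be chosen of Hodge type `(p, p)`; THEN the middle top splitting has the MAXIMAL index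
**`[Hdgᵖ(X, ℤ) : ℤγ_p ⊕ γ_p^⊥] = C(2p, p)·∏_{i<p} d_{p+i}/dᵢ`** (`= C(2p, p)` for a principal polarisation).
[cite: Lange2023AbelianVarietiesComplex, §6.2.4 (PDF p. 310 L9–L13); §5.4.1 (5.22)–(5.23) (PDF p. 275); §7.3.1 Thm. 7.3.1] [cite: Kitaoka1993, Ch. 5 Prop. 5.3.3 (proof)] -/
theorem IsPolarizationType.index_range_restrict_eq_one_iff_of_middle (hd : IsPolarizationType Φ η d) (hη : IsRiemannForm Φ η)
    (hp : p ≤ j + 2) (hg : p + p = j + 2) (e : Fin n ≃ ι) (hn : 2 * p + 2 * p = n) {B : BilinForm ℤ ↥(integralForms Φ (2 * p))}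
    (hB : ∀ x y : ↥(integralForms Φ (2 * p)),
      ((B x y : ℤ) : ℂ) = poincarePairing Φ e hn (x : E [⋀^Fin (2 * p)]→L[ℝ] ℂ) (y : E [⋀^Fin (2 * p)]→L[ℝ] ℂ))
    (γM : ↥(AddSubgroup.toIntSubmodule ((integralHodgeClassesIn Φ (2 * p) p).addSubgroupOf (integralForms Φ (2 * p)))))
    (hγM : wedgePow (ofRealForm η) p = ((p.factorial * ∏ i : Fin p, d (Fin.castLE hp i) : ℕ) : ℂ) •
      (((γM : ↥(AddSubgroup.toIntSubmodule ((integralHodgeClassesIn Φ (2 * p) p).addSubgroupOf (integralForms Φ (2 * p))))) : ↥(integralForms Φ (2 * p))) : E [⋀^Fin (2 * p)]→L[ℝ] ℂ))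
    (Λ : Submodule ℤ ↥(AddSubgroup.toIntSubmodule ((integralHodgeClassesIn Φ (2 * p) p).addSubgroupOf (integralForms Φ (2 * p))))) (hΛ : ∀ x, x ∈ Λ ↔ ∃ a : ℤ, a • γM = x) :
    ((LinearMap.range (B.restrict (AddSubgroup.toIntSubmodule ((integralHodgeClassesIn Φ (2 * p) p).addSubgroupOf (integralForms Φ (2 * p)))) γM)).toAddSubgroup.index = 1 ↔
        ∃ y : ↥(AddSubgroup.toIntSubmodule ((integralHodgeClassesIn Φ (2 * p) p).addSubgroupOf (integralForms Φ (2 * p)))), B (γM : ↥(integralForms Φ (2 * p))) (y : ↥(integralForms Φ (2 * p))) = 1) ∧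
      ((LinearMap.range (B.restrict (AddSubgroup.toIntSubmodule ((integralHodgeClassesIn Φ (2 * p) p).addSubgroupOf (integralForms Φ (2 * p)))) γM)).toAddSubgroup.index = 1 →
        (Λ ⊔ (B.restrict (AddSubgroup.toIntSubmodule ((integralHodgeClassesIn Φ (2 * p) p).addSubgroupOf (integralForms Φ (2 * p))))).orthogonal Λ).toAddSubgroup.index =
            (j + 2).choose p * ((∏ i, d i) / ((∏ i : Fin p, d (Fin.castLE hp i)) * ∏ i : Fin p, d (Fin.castLE hp i))) ∧
          (Λ ⊔ (B.restrict (AddSubgroup.toIntSubmodule ((integralHodgeClassesIn Φ (2 * p) p).addSubgroupOf (integralForms Φ (2 * p))))).orthogonal Λ).toAddSubgroup.index * (p.factorial * ∏ i : Fin p, d (Fin.castLE hp i)) ^ 2 = (j + 2).factorial * ∏ i, d i) := by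
  refine ⟨(index_range_eq_one_iff_exists_eq_one₉₇ (B.restrict (AddSubgroup.toIntSubmodule ((integralHodgeClassesIn Φ (2 * p) p).addSubgroupOf (integralForms Φ (2 * p))))) γM).trans ⟨fun ⟨y, hy⟩ ↦ ⟨y, hy⟩, fun ⟨y, hy⟩ ↦ ⟨y, hy⟩⟩, fun h1 ↦ ?_⟩
  have h := hd.index_middle_splitting_mul_index_range_mul_content_sq_eq hη hp hg e hn hB γM hγM Λ hΛ
  have h' := (hd.index_middle_splitting_mul_index_range_eq_choose_mul hη hp hg e hn hB γM hγM Λ hΛ).1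
  rw [h1, mul_one] at h h'
  exact ⟨h', h.1⟩

/-- **`[Hdgᵖ(X, ℤ) : ℤγ_p ⊕ γ_p^⊥] = 1` (the minimal class splits off the middle Hodge lattice EXACTLY) iff `Hdgᵖ(X, ℤ) = ℤγ_p + γ_p^⊥` iff
`[ℤ : ⟨γ_p, Hdgᵖ(X, ℤ)⟩_e] = C(2p, p)·∏_{i<p} d_{p+i}/dᵢ = |⟨γ_p, γ_p⟩|`**, i.e. iff every intersection number `⟨γ_p, y⟩`, `y ∈ Hdgᵖ(X, ℤ)`, is a multiple
of `⟨γ_p, γ_p⟩` — e.g. on a Mattuck-general polarised torus, where `Hdgᵖ(X, ℤ) = ℤγ_p` (below).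
[cite: Lange2023AbelianVarietiesComplex, §5.4.1 (5.22)–(5.23) (PDF p. 275); §7.3.1 Thm. 7.3.1, Prop. 7.3.3 (PDF pp. 336–337)] [cite: Kitaoka1993, Ch. 5 Prop. 5.3.3 (proof)] [cite: Huybrechts2016K3, Ch. 14 §0.2] -/
theorem IsPolarizationType.index_middle_splitting_eq_one_iff (hd : IsPolarizationType Φ η d) (hη : IsRiemannForm Φ η)
    (hp : p ≤ j + 2) (hg : p + p = j + 2) (e : Fin n ≃ ι) (hn : 2 * p + 2 * p = n) {B : BilinForm ℤ ↥(integralForms Φ (2 * p))}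
    (hB : ∀ x y : ↥(integralForms Φ (2 * p)),
      ((B x y : ℤ) : ℂ) = poincarePairing Φ e hn (x : E [⋀^Fin (2 * p)]→L[ℝ] ℂ) (y : E [⋀^Fin (2 * p)]→L[ℝ] ℂ))
    (γM : ↥(AddSubgroup.toIntSubmodule ((integralHodgeClassesIn Φ (2 * p) p).addSubgroupOf (integralForms Φ (2 * p)))))
    (hγM : wedgePow (ofRealForm η) p = ((p.factorial * ∏ i : Fin p, d (Fin.castLE hp i) : ℕ) : ℂ) •
      (((γM : ↥(AddSubgroup.toIntSubmodule ((integralHodgeClassesIn Φ (2 * p) p).addSubgroupOf (integralForms Φ (2 * p))))) : ↥(integralForms Φ (2 * p))) : E [⋀^Fin (2 * p)]→L[ℝ] ℂ))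
    (Λ : Submodule ℤ ↥(AddSubgroup.toIntSubmodule ((integralHodgeClassesIn Φ (2 * p) p).addSubgroupOf (integralForms Φ (2 * p))))) (hΛ : ∀ x, x ∈ Λ ↔ ∃ a : ℤ, a • γM = x) :
    ((Λ ⊔ (B.restrict (AddSubgroup.toIntSubmodule ((integralHodgeClassesIn Φ (2 * p) p).addSubgroupOf (integralForms Φ (2 * p))))).orthogonal Λ).toAddSubgroup.index = 1 ↔ Λ ⊔ (B.restrict (AddSubgroup.toIntSubmodule ((integralHodgeClassesIn Φ (2 * p) p).addSubgroupOf (integralForms Φ (2 * p))))).orthogonal Λ = ⊤) ∧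
      ((Λ ⊔ (B.restrict (AddSubgroup.toIntSubmodule ((integralHodgeClassesIn Φ (2 * p) p).addSubgroupOf (integralForms Φ (2 * p))))).orthogonal Λ).toAddSubgroup.index = 1 ↔
        (LinearMap.range (B.restrict (AddSubgroup.toIntSubmodule ((integralHodgeClassesIn Φ (2 * p) p).addSubgroupOf (integralForms Φ (2 * p)))) γM)).toAddSubgroup.index =
          (j + 2).choose p * ((∏ i, d i) / ((∏ i : Fin p, d (Fin.castLE hp i)) * ∏ i : Fin p, d (Fin.castLE hp i)))) ∧
      ((Λ ⊔ (B.restrict (AddSubgroup.toIntSubmodule ((integralHodgeClassesIn Φ (2 * p) p).addSubgroupOf (integralForms Φ (2 * p))))).orthogonal Λ).toAddSubgroup.index = 1 ↔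
        (LinearMap.range (B.restrict (AddSubgroup.toIntSubmodule ((integralHodgeClassesIn Φ (2 * p) p).addSubgroupOf (integralForms Φ (2 * p)))) γM)).toAddSubgroup.index = (B (γM : ↥(integralForms Φ (2 * p))) (γM : ↥(integralForms Φ (2 * p)))).natAbs) := by
  have h := hd.index_middle_splitting_mul_index_range_mul_content_sq_eq hη hp hg e hn hB γM hγM Λ hΛ
  have h' := (hd.index_middle_splitting_mul_index_range_eq_choose_mul hη hp hg e hn hB γM hγM Λ hΛ).1
  have key : ∀ {J m N : ℕ}, J * m = N → 0 < m → (J = 1 ↔ m = N) := fun {J m N} hJ hm ↦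
    ⟨fun h1 ↦ by rw [← hJ, h1, one_mul], fun h2 ↦ Nat.eq_of_mul_eq_mul_right hm (by rw [hJ, h2, one_mul])⟩
  exact ⟨by rw [AddSubgroup.index_eq_one, Submodule.toAddSubgroup_eq_top], key h' h.2.2.2, key h.2.1 h.2.2.2⟩

/-- **`Hdgᵖ(X, ℤ) = ℤγ_p` ⟹ `[Hdgᵖ(X, ℤ) : ℤγ_p ⊕ γ_p^⊥] = 1` and `[ℤ : ⟨γ_p, Hdgᵖ(X, ℤ)⟩_e] = C(2p, p)·∏_{i<p} d_{p+i}/dᵢ`**: on a polarised abelian variety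
of dimension `2p` whose middle Hodge lattice is generated by the minimal class (a Mattuck-general one: `dim_ℚ Bᵖ(X) = 1`, g36-#1 §7; `Sp ⊆ Hg(X)`, Lange Prop. 7.3.3)
the intersection numbers of `γ_p` with Hodge classes are exactly the multiples of `⟨γ_p, γ_p⟩ = ±C(2p, p)·∏ d_{p+i}/dᵢ`.
[cite: Lange2023AbelianVarietiesComplex, §7.3.1 Thm. 7.3.1, Prop. 7.3.3 (PDF pp. 336–337); §2.5.3 Cor. 2.5.17 (d)] [cite: BenoistDebarre2023SmoothSubvarietiesJacobians, §3 Prop. 3.3 and proof of Thm. 3.7 (p. 7)] -/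
theorem IsPolarizationType.index_range_restrict_eq_choose_mul_of_forall_mem_line (hd : IsPolarizationType Φ η d) (hη : IsRiemannForm Φ η)
    (hp : p ≤ j + 2) (hg : p + p = j + 2) (e : Fin n ≃ ι) (hn : 2 * p + 2 * p = n) {B : BilinForm ℤ ↥(integralForms Φ (2 * p))}
    (hB : ∀ x y : ↥(integralForms Φ (2 * p)),
      ((B x y : ℤ) : ℂ) = poincarePairing Φ e hn (x : E [⋀^Fin (2 * p)]→L[ℝ] ℂ) (y : E [⋀^Fin (2 * p)]→L[ℝ] ℂ))
    (γM : ↥(AddSubgroup.toIntSubmodule ((integralHodgeClassesIn Φ (2 * p) p).addSubgroupOf (integralForms Φ (2 * p)))))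
    (hγM : wedgePow (ofRealForm η) p = ((p.factorial * ∏ i : Fin p, d (Fin.castLE hp i) : ℕ) : ℂ) •
      (((γM : ↥(AddSubgroup.toIntSubmodule ((integralHodgeClassesIn Φ (2 * p) p).addSubgroupOf (integralForms Φ (2 * p))))) : ↥(integralForms Φ (2 * p))) : E [⋀^Fin (2 * p)]→L[ℝ] ℂ))
    (Λ : Submodule ℤ ↥(AddSubgroup.toIntSubmodule ((integralHodgeClassesIn Φ (2 * p) p).addSubgroupOf (integralForms Φ (2 * p))))) (hΛ : ∀ x, x ∈ Λ ↔ ∃ a : ℤ, a • γM = x) (hgen : ∀ x : ↥(AddSubgroup.toIntSubmodule ((integralHodgeClassesIn Φ (2 * p) p).addSubgroupOf (integralForms Φ (2 * p)))), ∃ a : ℤ, a • γM = x) :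
    (Λ ⊔ (B.restrict (AddSubgroup.toIntSubmodule ((integralHodgeClassesIn Φ (2 * p) p).addSubgroupOf (integralForms Φ (2 * p))))).orthogonal Λ).toAddSubgroup.index = 1 ∧
      (LinearMap.range (B.restrict (AddSubgroup.toIntSubmodule ((integralHodgeClassesIn Φ (2 * p) p).addSubgroupOf (integralForms Φ (2 * p)))) γM)).toAddSubgroup.index =
        (j + 2).choose p * ((∏ i, d i) / ((∏ i : Fin p, d (Fin.castLE hp i)) * ∏ i : Fin p, d (Fin.castLE hp i))) := by
  have h := hd.index_middle_splitting_eq_one_iff hη hp hg e hn hB γM hγM Λ hΛ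
  have htop : Λ ⊔ (B.restrict (AddSubgroup.toIntSubmodule ((integralHodgeClassesIn Φ (2 * p) p).addSubgroupOf (integralForms Φ (2 * p))))).orthogonal Λ = ⊤ :=
    eq_top_iff.2 fun x _ ↦ Submodule.mem_sup_left ((hΛ x).2 (hgen x))
  have h1 := h.1.2 htop
  exact ⟨h1, h.2.1.1 h1⟩

end Extremes

/-! ## §5 Low dimensions: abelian surfaces and fourfolds -/

section LowDimension

variable {ι : Type*} [Fintype ι] [DecidableEq ι] {E : Type*} [NormedAddCommGroup E] [NormedSpace ℂ E]
  {Φ : (ι → ℝ) ≃L[ℝ] E} {n : ℕ} {η : E [⋀^Fin 2]→L[ℝ] ℝ}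

/-- The arithmetic of the surface case: `J·m·d₀² = 2·(d₀·d₁)`, `d₀ > 0` give `J·m·d₀ = 2·d₁`. [folklore] -/
private theorem arith_surface₉₇ {J m a b : ℕ} (h : J * m * a ^ 2 = 2 * (a * b)) (ha : 0 < a) : J * m * a = 2 * b :=
  Nat.eq_of_mul_eq_mul_right ha (by rw [mul_assoc 2 b a, mul_comm b a, ← h]; ring)

/-- **Abelian surface of type `(d₁, d₂)`: `[NS(X) : ℤγ₁ ⊕ γ₁^⊥] · [ℤ : (γ₁ · NS(X))] · d₁ = 2·d₂`** for the intersection form on `H²(X, ℤ)` and the primitive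
polarisation class `γ₁ = θ/d₁` (`NS(X) = Hdg¹(X, ℤ)`; `γ₁² = 2d₂/d₁`): e.g. type `(1, d)`: `[NS(X) : ℤθ ⊕ θ^⊥] · [ℤ : (θ · NS(X))] = 2d`.
[cite: Lange2023AbelianVarietiesComplex, §5.4.1 (5.22)–(5.23) (PDF p. 275); §2.5.3 Cor. 2.5.17 (d) (PDF p. 135); §1.5.1 (PDF p. 51)] [cite: Huybrechts2016K3, Ch. 14 §0.2; Ch. 3 §2.3] -/
theorem IsPolarizationType.index_middle_splitting_mul_index_range_mul_eq_of_surface {d : Fin 2 → ℕ} (hd : IsPolarizationType Φ η d)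
    (hη : IsRiemannForm Φ η) (e : Fin n ≃ ι) (hn : 2 * 1 + 2 * 1 = n) {B : BilinForm ℤ ↥(integralForms Φ (2 * 1))}
    (hB : ∀ x y : ↥(integralForms Φ (2 * 1)),
      ((B x y : ℤ) : ℂ) = poincarePairing Φ e hn (x : E [⋀^Fin (2 * 1)]→L[ℝ] ℂ) (y : E [⋀^Fin (2 * 1)]→L[ℝ] ℂ))
    (γM : ↥(AddSubgroup.toIntSubmodule ((integralHodgeClassesIn Φ (2 * 1) 1).addSubgroupOf (integralForms Φ (2 * 1)))))
    (hγM : wedgePow (ofRealForm η) 1 = ((Nat.factorial 1 * ∏ i : Fin 1, d (Fin.castLE (Nat.le_add_left 1 1) i) : ℕ) : ℂ) •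
      (((γM : ↥(AddSubgroup.toIntSubmodule ((integralHodgeClassesIn Φ (2 * 1) 1).addSubgroupOf (integralForms Φ (2 * 1))))) : ↥(integralForms Φ (2 * 1))) : E [⋀^Fin (2 * 1)]→L[ℝ] ℂ))
    (Λ : Submodule ℤ ↥(AddSubgroup.toIntSubmodule ((integralHodgeClassesIn Φ (2 * 1) 1).addSubgroupOf (integralForms Φ (2 * 1))))) (hΛ : ∀ x, x ∈ Λ ↔ ∃ a : ℤ, a • γM = x) :
    (Λ ⊔ (B.restrict (AddSubgroup.toIntSubmodule ((integralHodgeClassesIn Φ (2 * 1) 1).addSubgroupOf (integralForms Φ (2 * 1))))).orthogonal Λ).toAddSubgroup.index * (LinearMap.range (B.restrict (AddSubgroup.toIntSubmodule ((integralHodgeClassesIn Φ (2 * 1) 1).addSubgroupOf (integralForms Φ (2 * 1)))) γM)).toAddSubgroup.index * d 0 = 2 * d 1 := by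
  have h : (Λ ⊔ (B.restrict (AddSubgroup.toIntSubmodule ((integralHodgeClassesIn Φ (2 * 1) 1).addSubgroupOf (integralForms Φ (2 * 1))))).orthogonal Λ).toAddSubgroup.index * (LinearMap.range (B.restrict (AddSubgroup.toIntSubmodule ((integralHodgeClassesIn Φ (2 * 1) 1).addSubgroupOf (integralForms Φ (2 * 1)))) γM)).toAddSubgroup.index *
      (Nat.factorial 1 * ∏ i : Fin 1, d (Fin.castLE (Nat.le_add_left 1 1) i)) ^ 2 = Nat.factorial 2 * ∏ i : Fin 2, d i :=
    (hd.index_middle_splitting_mul_index_range_mul_content_sq_eq hη (Nat.le_add_left 1 1) rfl e hn hB γM hγM Λ hΛ).1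
  have h0 : d (Fin.castLE (Nat.le_add_left 1 1) 0) = d 0 := rfl
  simp only [Nat.factorial_one, one_mul, Fin.prod_univ_one, h0, Nat.factorial_two, Fin.prod_univ_two] at h
  exact arith_surface₉₇ h (hd.pos hη 0)

/-- **Principally polarised abelian surface: `[NS(X) : ℤθ ⊕ θ^⊥] · [ℤ : (θ · NS(X))] = 2`** (`θ² = 2`): either `θ` splits off `NS(X)` and all degrees `(θ · D)` are
even, or `ℤθ ⊕ θ^⊥` has index `2` in `NS(X)` and some divisor class has odd degree.
[cite: Lange2023AbelianVarietiesComplex, §5.4.1 (5.22)–(5.23) (PDF p. 275); §2.1.1; §2.5.3 Cor. 2.5.17 (d)] [cite: Huybrechts2016K3, Ch. 3 §2.3; Ch. 14 §0.2] -/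
theorem IsPolarizationType.index_middle_splitting_mul_index_range_eq_two_of_surface {d : Fin 2 → ℕ} (hd : IsPolarizationType Φ η d)
    (hη : IsRiemannForm Φ η) (h1 : ∀ i, d i = 1) (e : Fin n ≃ ι) (hn : 2 * 1 + 2 * 1 = n) {B : BilinForm ℤ ↥(integralForms Φ (2 * 1))}
    (hB : ∀ x y : ↥(integralForms Φ (2 * 1)),
      ((B x y : ℤ) : ℂ) = poincarePairing Φ e hn (x : E [⋀^Fin (2 * 1)]→L[ℝ] ℂ) (y : E [⋀^Fin (2 * 1)]→L[ℝ] ℂ))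
    (γM : ↥(AddSubgroup.toIntSubmodule ((integralHodgeClassesIn Φ (2 * 1) 1).addSubgroupOf (integralForms Φ (2 * 1)))))
    (hγM : wedgePow (ofRealForm η) 1 = ((Nat.factorial 1 * ∏ i : Fin 1, d (Fin.castLE (Nat.le_add_left 1 1) i) : ℕ) : ℂ) •
      (((γM : ↥(AddSubgroup.toIntSubmodule ((integralHodgeClassesIn Φ (2 * 1) 1).addSubgroupOf (integralForms Φ (2 * 1))))) : ↥(integralForms Φ (2 * 1))) : E [⋀^Fin (2 * 1)]→L[ℝ] ℂ))
    (Λ : Submodule ℤ ↥(AddSubgroup.toIntSubmodule ((integralHodgeClassesIn Φ (2 * 1) 1).addSubgroupOf (integralForms Φ (2 * 1))))) (hΛ : ∀ x, x ∈ Λ ↔ ∃ a : ℤ, a • γM = x) :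
    (Λ ⊔ (B.restrict (AddSubgroup.toIntSubmodule ((integralHodgeClassesIn Φ (2 * 1) 1).addSubgroupOf (integralForms Φ (2 * 1))))).orthogonal Λ).toAddSubgroup.index * (LinearMap.range (B.restrict (AddSubgroup.toIntSubmodule ((integralHodgeClassesIn Φ (2 * 1) 1).addSubgroupOf (integralForms Φ (2 * 1)))) γM)).toAddSubgroup.index = 2 := by
  have h : (Λ ⊔ (B.restrict (AddSubgroup.toIntSubmodule ((integralHodgeClassesIn Φ (2 * 1) 1).addSubgroupOf (integralForms Φ (2 * 1))))).orthogonal Λ).toAddSubgroup.index * (LinearMap.range (B.restrict (AddSubgroup.toIntSubmodule ((integralHodgeClassesIn Φ (2 * 1) 1).addSubgroupOf (integralForms Φ (2 * 1)))) γM)).toAddSubgroup.index =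
      Nat.choose 2 1 :=
    (hd.index_middle_splitting_mul_index_range_eq_choose_of_type_one hη h1 (Nat.le_add_left 1 1) rfl e hn hB γM hγM Λ hΛ).1
  rw [h]
  rfl

/-- **Principally polarised abelian fourfold: `[Hdg²(X, ℤ) : ℤ(θ²/2) ⊕ (θ²/2)^⊥] · [ℤ : ⟨θ²/2, Hdg²(X, ℤ)⟩] = 6`** for the cup product on `H⁴(X, ℤ) ≅ U^{⊕35}`
(`⟨θ²/2, θ²/2⟩ = C(4, 2) = 6`), so the index of the middle top splitting of a p.p. abelian fourfold is `1`, `2`, `3` or `6`.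
[cite: Lange2023AbelianVarietiesComplex, §5.4.1 (5.22)–(5.23) (PDF p. 275); §7.3.1 Thm. 7.3.1; §2.1.1] [cite: BenoistDebarre2023SmoothSubvarietiesJacobians, §1 (p. 3); §3 Prop. 3.3] -/
theorem IsPolarizationType.index_middle_splitting_mul_index_range_eq_six_of_fourfold {d : Fin 4 → ℕ} (hd : IsPolarizationType Φ η d)
    (hη : IsRiemannForm Φ η) (h1 : ∀ i, d i = 1) (e : Fin n ≃ ι) (hn : 2 * 2 + 2 * 2 = n) {B : BilinForm ℤ ↥(integralForms Φ (2 * 2))}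
    (hB : ∀ x y : ↥(integralForms Φ (2 * 2)),
      ((B x y : ℤ) : ℂ) = poincarePairing Φ e hn (x : E [⋀^Fin (2 * 2)]→L[ℝ] ℂ) (y : E [⋀^Fin (2 * 2)]→L[ℝ] ℂ))
    (γM : ↥(AddSubgroup.toIntSubmodule ((integralHodgeClassesIn Φ (2 * 2) 2).addSubgroupOf (integralForms Φ (2 * 2)))))
    (hγM : wedgePow (ofRealForm η) 2 = ((Nat.factorial 2 * ∏ i : Fin 2, d (Fin.castLE (Nat.le_add_left 2 2) i) : ℕ) : ℂ) •
      (((γM : ↥(AddSubgroup.toIntSubmodule ((integralHodgeClassesIn Φ (2 * 2) 2).addSubgroupOf (integralForms Φ (2 * 2))))) : ↥(integralForms Φ (2 * 2))) : E [⋀^Fin (2 * 2)]→L[ℝ] ℂ))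
    (Λ : Submodule ℤ ↥(AddSubgroup.toIntSubmodule ((integralHodgeClassesIn Φ (2 * 2) 2).addSubgroupOf (integralForms Φ (2 * 2))))) (hΛ : ∀ x, x ∈ Λ ↔ ∃ a : ℤ, a • γM = x) :
    (Λ ⊔ (B.restrict (AddSubgroup.toIntSubmodule ((integralHodgeClassesIn Φ (2 * 2) 2).addSubgroupOf (integralForms Φ (2 * 2))))).orthogonal Λ).toAddSubgroup.index * (LinearMap.range (B.restrict (AddSubgroup.toIntSubmodule ((integralHodgeClassesIn Φ (2 * 2) 2).addSubgroupOf (integralForms Φ (2 * 2)))) γM)).toAddSubgroup.index = 6 ∧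
      (Λ ⊔ (B.restrict (AddSubgroup.toIntSubmodule ((integralHodgeClassesIn Φ (2 * 2) 2).addSubgroupOf (integralForms Φ (2 * 2))))).orthogonal Λ).toAddSubgroup.index ∣ 6 := by
  have h : (Λ ⊔ (B.restrict (AddSubgroup.toIntSubmodule ((integralHodgeClassesIn Φ (2 * 2) 2).addSubgroupOf (integralForms Φ (2 * 2))))).orthogonal Λ).toAddSubgroup.index * (LinearMap.range (B.restrict (AddSubgroup.toIntSubmodule ((integralHodgeClassesIn Φ (2 * 2) 2).addSubgroupOf (integralForms Φ (2 * 2)))) γM)).toAddSubgroup.index =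
      Nat.choose 4 2 :=
    (hd.index_middle_splitting_mul_index_range_eq_choose_of_type_one hη h1 (Nat.le_add_left 2 2) rfl e hn hB γM hγM Λ hΛ).1
  have h6 : Nat.choose 4 2 = 6 := by decide
  rw [h6] at h
  exact ⟨h, Dvd.intro _ h⟩

end LowDimension

/-! ## §6 The middle top splitting, data-free -/

section DataFree

variable {ι : Type*} [Fintype ι] [DecidableEq ι] {E : Type*} [NormedAddCommGroup E] [NormedSpace ℂ E]
  {Φ : (ι → ℝ) ≃L[ℝ] E} {j p : ℕ} {η : E [⋀^Fin 2]→L[ℝ] ℝ} {d : Fin (j + 2) → ℕ}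

/-- **THE MIDDLE TOP SPLITTING, DATA-FREE.** On a polarised abelian variety `X` of dimension `2p` and type `(d₁, …, d_{2p})` there are an orientation `e` of
the lattice, the cup-product form `B = ⟨·,·⟩_e` on `H^{2p}(X, ℤ)` (symmetric) and the minimal class `γ_p ∈ Hdgᵖ(X, ℤ)` (`θ^{∧p} = (p!·d₁⋯d_p)·γ_p`) with:
`⟨γ_p, H^{2p}(X, ℤ)⟩ = ℤ`, `0 < sign(e)·⟨γ_p, γ_p⟩ = C(2p, p)·∏_{i<p} d_{p+i}/dᵢ`, and for the line `Λ = ℤγ_p` in `M = Hdgᵖ(X, ℤ)`: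
`[M : Λ ⊕ Λ^⊥] · [ℤ : ⟨γ_p, M⟩] = C(2p, p)·∏_{i<p} d_{p+i}/dᵢ`, both indices positive, `Λ ∩ Λ^⊥ = 0`, `rk Λ = 1`, `rk Λ + rk Λ^⊥ = rk M`.
[cite: Lange2023AbelianVarietiesComplex, §5.4.1 Thm. 5.4.2 and (5.22)–(5.23) (PDF p. 275); §2.5.3 Thm. 2.5.16, Cor. 2.5.17 (d) (PDF p. 135); §6.2.4 (PDF p. 310); §7.3.1 Thm. 7.3.1]
[cite: Kitaoka1993, Ch. 5 Prop. 5.3.3 (proof)] [cite: BenoistDebarre2023SmoothSubvarietiesJacobians, §1 (p. 3); §3 Prop. 3.3] -/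
theorem IsPolarizationType.exists_middle_splitting (hd : IsPolarizationType Φ η d) (hη : IsRiemannForm Φ η) (hp : p ≤ j + 2) (hg : p + p = j + 2) :
    ∃ (e : Fin (2 * p + 2 * p) ≃ ι) (B : BilinForm ℤ ↥(integralForms Φ (2 * p))) (γM : ↥(AddSubgroup.toIntSubmodule ((integralHodgeClassesIn Φ (2 * p) p).addSubgroupOf (integralForms Φ (2 * p))))),
      (∀ x y : ↥(integralForms Φ (2 * p)),
        ((B x y : ℤ) : ℂ) = poincarePairing Φ e rfl (x : E [⋀^Fin (2 * p)]→L[ℝ] ℂ) (y : E [⋀^Fin (2 * p)]→L[ℝ] ℂ)) ∧ B.IsSymm ∧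
      wedgePow (ofRealForm η) p = ((p.factorial * ∏ i : Fin p, d (Fin.castLE hp i) : ℕ) : ℂ) •
        (((γM : ↥(AddSubgroup.toIntSubmodule ((integralHodgeClassesIn Φ (2 * p) p).addSubgroupOf (integralForms Φ (2 * p))))) : ↥(integralForms Φ (2 * p))) : E [⋀^Fin (2 * p)]→L[ℝ] ℂ) ∧
      (LinearMap.range (B (γM : ↥(integralForms Φ (2 * p))))).toAddSubgroup = ⊤ ∧
      orientationSign Φ e * B (γM : ↥(integralForms Φ (2 * p))) (γM : ↥(integralForms Φ (2 * p))) =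
        (((j + 2).choose p * ((∏ i, d i) / ((∏ i : Fin p, d (Fin.castLE hp i)) * ∏ i : Fin p, d (Fin.castLE hp i))) : ℕ) : ℤ) ∧
      0 < orientationSign Φ e * B (γM : ↥(integralForms Φ (2 * p))) (γM : ↥(integralForms Φ (2 * p))) ∧
      ∀ (Λ : Submodule ℤ ↥(AddSubgroup.toIntSubmodule ((integralHodgeClassesIn Φ (2 * p) p).addSubgroupOf (integralForms Φ (2 * p))))), (∀ x, x ∈ Λ ↔ ∃ a : ℤ, a • γM = x) →
        (Λ ⊔ (B.restrict (AddSubgroup.toIntSubmodule ((integralHodgeClassesIn Φ (2 * p) p).addSubgroupOf (integralForms Φ (2 * p))))).orthogonal Λ).toAddSubgroup.index * (LinearMap.range (B.restrict (AddSubgroup.toIntSubmodule ((integralHodgeClassesIn Φ (2 * p) p).addSubgroupOf (integralForms Φ (2 * p)))) γM)).toAddSubgroup.index =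
            (j + 2).choose p * ((∏ i, d i) / ((∏ i : Fin p, d (Fin.castLE hp i)) * ∏ i : Fin p, d (Fin.castLE hp i))) ∧
          0 < (Λ ⊔ (B.restrict (AddSubgroup.toIntSubmodule ((integralHodgeClassesIn Φ (2 * p) p).addSubgroupOf (integralForms Φ (2 * p))))).orthogonal Λ).toAddSubgroup.index ∧ 0 < (LinearMap.range (B.restrict (AddSubgroup.toIntSubmodule ((integralHodgeClassesIn Φ (2 * p) p).addSubgroupOf (integralForms Φ (2 * p)))) γM)).toAddSubgroup.index ∧
          Λ ⊓ (B.restrict (AddSubgroup.toIntSubmodule ((integralHodgeClassesIn Φ (2 * p) p).addSubgroupOf (integralForms Φ (2 * p))))).orthogonal Λ = ⊥ ∧ finrank ℤ ↥Λ = 1 ∧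
          finrank ℤ ↥Λ + finrank ℤ ↥((B.restrict (AddSubgroup.toIntSubmodule ((integralHodgeClassesIn Φ (2 * p) p).addSubgroupOf (integralForms Φ (2 * p))))).orthogonal Λ) = finrank ℤ ↥(AddSubgroup.toIntSubmodule ((integralHodgeClassesIn Φ (2 * p) p).addSubgroupOf (integralForms Φ (2 * p)))) := by
  have hcard : Fintype.card ι = 2 * p + 2 * p := by rw [hd.card_eq]; omega
  let e : Fin (2 * p + 2 * p) ≃ ι := (Fintype.equivFinOfCardEq hcard).symm
  refine (hd.exists_minimalClass_mem_toIntSubmodule hη hp).elim fun γM hγM ↦ ?_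
  refine (hd.exists_mem_integralForms_wedgePow_eq_content_smul (Nat.zero_le (j + 2))).elim fun γ0 hγ0' ↦ ?_
  have hγ0Z := hγ0'.1
  have hγ0 := hγ0'.2
  have hn₀ : 2 * p + (2 * 0 + 2 * p) = 2 * p + 2 * p := by omega
  refine (exists_bilinForm_eq_poincarePairing_wedge_of_degree Φ hγ0Z e hn₀).elim fun B hB₀ ↦ ?_
  -- `γ_0 = θ^{∧0} = 1`, so `B` is the cup product
  have hγ0eq : γ0 = wedgePow (ofRealForm η) 0 := by
    rw [hγ0]
    simp
  have hB : ∀ x y : ↥(integralForms Φ (2 * p)),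
      ((B x y : ℤ) : ℂ) = poincarePairing Φ e rfl (x : E [⋀^Fin (2 * p)]→L[ℝ] ℂ) (y : E [⋀^Fin (2 * p)]→L[ℝ] ℂ) := fun x y ↦ by
    rw [hB₀, hγ0eq, poincarePairing_wedgePow_zero_wedge₉₇ Φ e (ofRealForm η) hn₀ rfl]
  have hkq : 2 * p + 0 = j + 2 := by omega
  have hsymm : B.IsSymm := hd.isSymm_of_eq_poincarePairing_wedge_of_even hη (even_two_mul p) hkq (Nat.zero_le _) hγ0 e hn₀ hB₀
  have h1 := hd.range_apply_minimalClass_eq_top_of_middle hη hp e rfl hB (γM : ↥(integralForms Φ (2 * p))) hγM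
  have h2 := hd.orientationSign_mul_apply_minimalClass_self_eq_choose_mul hη hp hg e rfl hB (γM : ↥(integralForms Φ (2 * p))) hγM
  refine ⟨e, B, γM, hB, hsymm, hγM, h1.1, h2.1, h2.2.1, fun Λ hΛ ↦ ?_⟩
  have h3 := hd.index_middle_splitting_mul_index_range_mul_content_sq_eq hη hp hg e rfl hB γM hγM Λ hΛ
  have h4 := hd.index_middle_splitting_mul_index_range_eq_choose_mul hη hp hg e rfl hB γM hγM Λ hΛ
  have h5 := hd.middle_splitting hη hp hg e rfl hB γM hγM Λ hΛ
  exact ⟨h4.1, h3.2.2.1, h3.2.2.2, h5.1, h5.2.2.1, h5.2.2.2⟩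

end DataFree

end Literature.Geometry.Kaehler.ComplexTorus

end
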